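import Literature.Topology.FourManifolds.LatticeFormsDivisorOneStabiliserQuotient
import Literature.Topology.FourManifolds.LatticeFormsPolarisationTypesSplitNonsplit
import Literature.Topology.FourManifolds.LatticeFormsPrimitiveOrthogonal
import HarnessLib

/-!
# `|O(L_{2t}, h_d)/Õ(L_{2t}, h_d)| = 2^{ρ(t)}` for EVERY split `h_d` (Gritsenko–Hulek–Sankaran, *Compositio Math.* 146 (2010)
# Prop. 4.12 (ii), `f = 1`, combined with Example 4.8: one `Õ(L_{2t})`-orbit of split vectors of each degree)

Trunk T-4MAN vocabulary; sequel of `LatticeFormsDivisorOneStabiliserQuotient.lean` (rows g42-#7/#8: the count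
`|O(L, h)|_{h^⊥} / Õ| = |O(q_L)|` for `(h, h') = 1`, and `= 2^{ρ(t)}` for the representative `h_d = e₁ + d f₁` of the models
`E₈(−1)^{⊕m} ⊕ U^{⊕(k+2)} ⊕ ⟨−2t⟩`) and of `LatticeFormsPolarisationTypesSplitNonsplit.lean` (row g41-#4, Example 4.8: the
split vectors of a given square form one `Õ`-orbit). Written for lane `lit-hodgefound` (Track 2 foundations; prover seat
`lit-hodgefound-p18`, gen 42, row g42-#9). THEOREMS ONLY — no definition, no named fact, no instance, no notation.

## Source, verbatim (V. Gritsenko, K. Hulek, G. K. Sankaran, Compositio Math. 146 (2010) 404–434, arXiv numbering §4,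
held text `paper:arxiv-0802.2078` p. 12)

"**Example 4.8.** Let `f = 1`. From the Proposition 4.6 it follows that for any `t` and `d` there is only one
`Õ(L_{2t})`-orbit of primitive vectors `h_d` with `div(h_d) = 1`. […] **Proposition 4.12.** Let `h_d ∈ L_{2t}` be a primitive
vector such that `h_d² = 2d` and `div(h_d) = f`. Assume that `w = 1` […] (ii) The factor group `O(L_{2t}, h_d)/Õ(L_{2t}, h_d)`
is an abelian `2`-group, which is of order `2^{ρ(t/f)}` if `f` is odd." Here `L_{2t} = L_{K3} ⊕ ⟨−2t⟩ = 3U ⊕ 2E₈(−1) ⊕ ⟨−2t⟩`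
(§1 of the paper).

## What is here (all proved)

* §1 **Transport along an isometry.** For an isometry `e : L ⥲ L'` and `h ∈ L`, conjugation by the induced isometry
  `f : h^⊥ ⥲ (e h)^⊥` (`exists_isometryEquiv_restrict_orthogonal_coe_apply_eq`) is a bijection
  `O(L, h)|_{h^⊥} ⥲ O(L', e h)|_{(e h)^⊥}` compatible with "`γ̄ = γ̄'`", so the two stabiliser quotients have the same
  cardinality (`natCard_quot_exists_isometryEquiv_apply_eq_eq_of_isometryEquiv`).
* §2 **Prop. 4.12 (ii), `f = 1`, for every split vector of the models** `L = E₈(−1)^{⊕m} ⊕ U^{⊕(k+2)} ⊕ ⟨−2t⟩` (GHS's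
  `L_{2t}`: `m = 2`, `k = 1`): if `u ∈ L`, `u² = 2d ≠ 0` and `(u, u') = 1` for some `u'`, then
  `|O(L, u)|_{u^⊥} / Õ| = 2^{ρ(t)}` (`natCard_quot_exists_isometryEquiv_apply_eq_model_of_apply_eq_one`) — by Example 4.8
  (`exists_stable_isometryEquiv_apply_eq_of_apply_eq_one_of_apply_eq_one`) `u` is `Õ(L)`-equivalent to `e₁ + d f₁`, and §1.
* Reading notes. The classes `γ̄ = γ̄'` are the cosets of `Õ(u^⊥) ≅ Õ(L, u)` (Prop. 4.12 (i),
  `LatticeFormsStableOrthogonalGroupStabiliser.lean`); no group structure is declared, so "abelian `2`-group" is not stated.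

## References

* [GritsenkoHulekSankaran2010Symplectic] V. Gritsenko, K. Hulek, G. K. Sankaran, Moduli spaces of irreducible symplectic
  manifolds, Compositio Math. 146 (2010): §4 Example 4.8, Prop. 4.12 (ii).
* [GritsenkoHulekSankaran2007HM] V. Gritsenko, K. Hulek, G. K. Sankaran, The Hirzebruch–Mumford volume for the orthogonal
  group and applications, Doc. Math. 12 (2007): §4 Lemma 4.3.
* [Huybrechts2016K3] D. Huybrechts, Lectures on K3 Surfaces, CUP 2016: Ch. 14 Example 1.11 (i) (`ℓ^⊥ ≅ (eℓ)^⊥`).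
-/

noncomputable section

open Module Function
open LinearMap (BilinForm)
open Literature.Topology.FourManifolds

namespace LinearMap.BilinForm

/-! ### §1 Transport of `O(L, h)|_{h^⊥} / Õ` along an isometry -/

section Transport

variable {M M' : Type*} [AddCommGroup M] [AddCommGroup M'] {B : BilinForm ℤ M} {B' : BilinForm ℤ M'}

/-- The isometry `h^⊥ ⥲ (e h)^⊥` induced by an isometry `e : L ⥲ L'` (restriction of `e`).
[cite: Huybrechts2016K3, Ch. 14 Example 1.11 (i)] [cite: GritsenkoHulekSankaran2010Symplectic, §4 Example 4.8] -/
theorem exists_isometryEquiv_restrict_orthogonal_coe_apply_eq (e : B.IsometryEquiv B') (h : M) :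
    ∃ f : (B.restrict (B.orthogonal (ℤ ∙ h))).IsometryEquiv (B'.restrict (B'.orthogonal (ℤ ∙ e h))),
      ∀ n : B.orthogonal (ℤ ∙ h), (f n : M') = e n :=
  ⟨{ (e : M ≃ₗ[ℤ] M').ofSubmodules _ _ (map_orthogonal_span_singleton e h) with
      map_app' := fun a b ↦ by
        change B' ((e : M ≃ₗ[ℤ] M').ofSubmodules _ _ (map_orthogonal_span_singleton e h) a : M')
          ((e : M ≃ₗ[ℤ] M').ofSubmodules _ _ (map_orthogonal_span_singleton e h) b : M') = B (a : M) (b : M)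
        rw [LinearEquiv.ofSubmodules_apply, LinearEquiv.ofSubmodules_apply]
        exact e.map_app _ _ }, fun _ ↦ rfl⟩

/-- **`|O(L, h)|_{h^⊥} / Õ| = |O(L', e h)|_{(e h)^⊥} / Õ|` along an isometry `e : L ⥲ L'`**: conjugation `γ ↦ f γ f⁻¹`
by the induced `f : h^⊥ ⥲ (e h)^⊥` carries restrictions of `O(L, h)` (`G ↦ e G e⁻¹`) to restrictions of `O(L', e h)` and
respects `γ̄ = γ̄'` (functoriality of `γ ↦ γ̄`). Used with Example 4.8 (one `Õ(L_{2t})`-orbit of split `h_d`).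
[cite: GritsenkoHulekSankaran2010Symplectic, §4 Example 4.8, Prop. 4.12 (ii)] -/
theorem natCard_quot_exists_isometryEquiv_apply_eq_eq_of_isometryEquiv (e : B.IsometryEquiv B') (h : M) :
    Nat.card (Quot fun γ γ' : {γ : (B.restrict (B.orthogonal (ℤ ∙ h))).IsometryEquiv (B.restrict (B.orthogonal (ℤ ∙ h))) //
        ∃ G : B.IsometryEquiv B, G h = h ∧ ∀ n : B.orthogonal (ℤ ∙ h), G n = γ n} ↦
        γ.1.discriminantGroupCongr = γ'.1.discriminantGroupCongr) =
      Nat.card (Quot fun γ γ' : {γ : (B'.restrict (B'.orthogonal (ℤ ∙ e h))).IsometryEquiv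
          (B'.restrict (B'.orthogonal (ℤ ∙ e h))) //
          ∃ G : B'.IsometryEquiv B', G (e h) = e h ∧ ∀ n : B'.orthogonal (ℤ ∙ e h), G n = γ n} ↦
          γ.1.discriminantGroupCongr = γ'.1.discriminantGroupCongr) := by
  obtain ⟨f, hf⟩ := exists_isometryEquiv_restrict_orthogonal_coe_apply_eq e h
  have hee' : ∀ x, e.symm (e x) = x := fun x ↦ e.toLinearEquiv.symm_apply_apply x
  have hff : ∀ n, f (f.symm n) = n := fun n ↦ f.toLinearEquiv.apply_symm_apply n
  have hff' : ∀ n, f.symm (f n) = n := fun n ↦ f.toLinearEquiv.symm_apply_apply n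
  have hf' : ∀ n : B'.orthogonal (ℤ ∙ e h), (f.symm n : M) = e.symm n := fun n ↦ by
    rw [← hee' (f.symm n : M), ← hf, hff]
  refine Nat.card_congr (Quot.congr
    { toFun := fun γ ↦ ⟨(f.symm.trans γ.1).trans f, ?_⟩
      invFun := fun γ' ↦ ⟨(f.trans γ'.1).trans f.symm, ?_⟩
      left_inv := fun γ ↦ Subtype.ext (DFunLike.ext _ _ fun n ↦ by
        simp only [IsometryEquiv.trans_apply, hff'])
      right_inv := fun γ' ↦ Subtype.ext (DFunLike.ext _ _ fun n ↦ by
        simp only [IsometryEquiv.trans_apply, hff]) } fun γ₁ γ₂ ↦ ?_)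
  · -- `G ↦ e G e⁻¹`
    obtain ⟨G, hGh, hGn⟩ := γ.2
    refine ⟨(e.symm.trans G).trans e, ?_, fun n ↦ ?_⟩
    · rw [IsometryEquiv.trans_apply, IsometryEquiv.trans_apply, hee', hGh]
    · rw [IsometryEquiv.trans_apply, IsometryEquiv.trans_apply, IsometryEquiv.trans_apply, IsometryEquiv.trans_apply, hf,
        ← hf', hGn]
  · -- `G' ↦ e⁻¹ G' e`
    obtain ⟨G', hGh, hGn⟩ := γ'.2
    refine ⟨(e.trans G').trans e.symm, ?_, fun n ↦ ?_⟩
    · rw [IsometryEquiv.trans_apply, IsometryEquiv.trans_apply, hGh, hee']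
    · rw [IsometryEquiv.trans_apply, IsometryEquiv.trans_apply, IsometryEquiv.trans_apply, IsometryEquiv.trans_apply, hf',
        ← hf, hGn]
  · -- `γ̄₁ = γ̄₂ ⟺ (f γ₁ f⁻¹)‾ = (f γ₂ f⁻¹)‾`
    change γ₁.1.discriminantGroupCongr = γ₂.1.discriminantGroupCongr ↔
      ((f.symm.trans γ₁.1).trans f).discriminantGroupCongr = ((f.symm.trans γ₂.1).trans f).discriminantGroupCongr
    simp only [IsometryEquiv.discriminantGroupCongr_trans, IsometryEquiv.discriminantGroupCongr_symm]
    refine ⟨fun hγ ↦ by rw [hγ], fun hc ↦ LinearEquiv.ext fun a ↦ ?_⟩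
    have h1 := LinearEquiv.congr_fun hc (f.discriminantGroupCongr a)
    simp only [LinearEquiv.trans_apply, LinearEquiv.symm_apply_apply] at h1
    exact f.discriminantGroupCongr.injective h1

end Transport

end LinearMap.BilinForm

/-! ### §2 Every split vector of `E₈(−1)^{⊕m} ⊕ U^{⊕(k+2)} ⊕ ⟨−2t⟩` -/

namespace Literature.Topology.FourManifolds

open LinearMap.BilinForm

/-- **GHS Prop. 4.12 (ii) for `f = 1`, every split vector**: in `L = E₈(−1)^{⊕m} ⊕ U^{⊕(k+2)} ⊕ ⟨−2t⟩` (`t ≥ 1`; GHS's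
`L_{2t} = L_{K3} ⊕ ⟨−2t⟩` is `m = 2`, `k = 1`), for every `u` with `u² = 2d ≠ 0` and `(u, u') = 1` for some `u'` (a split
polarisation, Def. 4.9) the restrictions of `O(L, u)` to `u^⊥`, modulo those acting alike on `D(u^⊥)` (i.e. modulo
`Õ(u^⊥) ≅ Õ(L, u)`), number **`2^{ρ(t)}`** ("`O(L_{2t}, h_d)/Õ(L_{2t}, h_d)` … is of order `2^{ρ(t/f)}` if `f` is odd", `f = 1`):
`u` is `Õ(L)`-equivalent to `e₁ + d f₁` (Example 4.8), transport (§1), and the count for `e₁ + d f₁`.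
[cite: GritsenkoHulekSankaran2010Symplectic, §4 Prop. 4.12 (ii), Example 4.8] [cite: GritsenkoHulekSankaran2007HM, §4 Lemma 4.3] -/
theorem natCard_quot_exists_isometryEquiv_apply_eq_model_of_apply_eq_one (m k : ℕ) {t : ℕ} (ht : 0 < t) {d : ℤ}
    (hd : d ≠ 0)
    (h₁ : (((LinearMap.BilinForm.pi fun _ : Fin m ↦ -e8Form).prod (hyperbolicSum (k + 2))).prod
        ((-(2 * t : ℤ)) • LinearMap.mul ℤ ℤ)).Nondegenerate)
    (h₂ : (((LinearMap.BilinForm.pi fun _ : Fin m ↦ -e8Form).prod (hyperbolicSum (k + 2))).prod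
        ((-(2 * t : ℤ)) • LinearMap.mul ℤ ℤ)).IsSymm)
    (h₃ : (((LinearMap.BilinForm.pi fun _ : Fin m ↦ -e8Form).prod (hyperbolicSum (k + 2))).prod
        ((-(2 * t : ℤ)) • LinearMap.mul ℤ ℤ)).IsEven)
    {u u' : ((Fin m → Fin 8 → ℤ) × ((Fin (k + 2) → ℤ) × (Fin (k + 2) → ℤ))) × ℤ}
    (hu : (((LinearMap.BilinForm.pi fun _ : Fin m ↦ -e8Form).prod (hyperbolicSum (k + 2))).prod
        ((-(2 * t : ℤ)) • LinearMap.mul ℤ ℤ)) u u = 2 * d)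
    (hu' : (((LinearMap.BilinForm.pi fun _ : Fin m ↦ -e8Form).prod (hyperbolicSum (k + 2))).prod
        ((-(2 * t : ℤ)) • LinearMap.mul ℤ ℤ)) u u' = 1) :
    Nat.card (Quot fun γ γ' : {γ : ((((LinearMap.BilinForm.pi fun _ : Fin m ↦ -e8Form).prod (hyperbolicSum (k + 2))).prod
          ((-(2 * t : ℤ)) • LinearMap.mul ℤ ℤ)).restrict
          ((((LinearMap.BilinForm.pi fun _ : Fin m ↦ -e8Form).prod (hyperbolicSum (k + 2))).prod
            ((-(2 * t : ℤ)) • LinearMap.mul ℤ ℤ)).orthogonal (ℤ ∙ u))).IsometryEquiv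
          ((((LinearMap.BilinForm.pi fun _ : Fin m ↦ -e8Form).prod (hyperbolicSum (k + 2))).prod
            ((-(2 * t : ℤ)) • LinearMap.mul ℤ ℤ)).restrict
            ((((LinearMap.BilinForm.pi fun _ : Fin m ↦ -e8Form).prod (hyperbolicSum (k + 2))).prod
              ((-(2 * t : ℤ)) • LinearMap.mul ℤ ℤ)).orthogonal (ℤ ∙ u))) //
        ∃ G : (((LinearMap.BilinForm.pi fun _ : Fin m ↦ -e8Form).prod (hyperbolicSum (k + 2))).prod
            ((-(2 * t : ℤ)) • LinearMap.mul ℤ ℤ)).IsometryEquiv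
            (((LinearMap.BilinForm.pi fun _ : Fin m ↦ -e8Form).prod (hyperbolicSum (k + 2))).prod
              ((-(2 * t : ℤ)) • LinearMap.mul ℤ ℤ)),
          G u = u ∧
            ∀ n : (((LinearMap.BilinForm.pi fun _ : Fin m ↦ -e8Form).prod (hyperbolicSum (k + 2))).prod
                ((-(2 * t : ℤ)) • LinearMap.mul ℤ ℤ)).orthogonal (ℤ ∙ u),
              G n = γ n} ↦
        γ.1.discriminantGroupCongr = γ'.1.discriminantGroupCongr) = 2 ^ t.primeFactors.card := by
  obtain ⟨hsQ, heQ, huQ⟩ := isSymm_isEven_isUnimodular_pi_neg_e8Form_prod_hyperbolicSum' m (k + 2)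
  have hP := twoHyperbolicPairs_pi_neg_e8Form_prod_hyperbolicSum_add_two m k
  obtain ⟨hh, hh', -⟩ := model_split_polarisation_apply m k t d
  obtain ⟨g, -, hgu⟩ := exists_stable_isometryEquiv_apply_eq_of_apply_eq_one_of_apply_eq_one t huQ heQ ht hP
    (u := u) (v := ((0, (Pi.single 0 1, d • Pi.single 0 1)), 0)) (by rw [hu, hh]) hu' hh'
  have key := natCard_quot_exists_isometryEquiv_apply_eq_eq_of_isometryEquiv g u
  rw [hgu] at key
  rw [key]
  exact natCard_quot_exists_isometryEquiv_apply_eq_model_split m k ht hd h₁ h₂ h₃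

end Literature.Topology.FourManifolds
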